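import Literature.MathematicalPhysics.QuantumFieldTheory.LatticeGauge
import HarnessLib

/-!
# The explicit 't Hooft-regime thresholds of Shen–Zhu–Zhu and Cao–Nissim–Sheffield, and the
# Cao–Nissim–Sheffield area law for `β < 1/(8(d-1))`

This file records, as real-valued definitions with their printed equivalences proved, the two
explicit strong-coupling thresholds of the Bakry–Émery ("dynamical") approach to lattice Yang–Mills
with 't Hooft-scaled Wilson action `S(Q) = N β Re ∑ₚ Tr(Q_p)`:

* Shen–Zhu–Zhu, CMP 400 (2023) 805–851 (arXiv:2204.12737), Assumption 1.1 and (1.3): the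
  Bakry–Émery constant `K_S = (N+2)/2 - 1 - 8N|β|(d-1)` (`SU(N)`), `(N+2)/4 - 1 - 8N|β|(d-1)`
  (`SO(N)`), positive iff `|β| < 1/(16(d-1))` resp. `|β| < 1/(32(d-1)) - 1/(16N(d-1))`
  (`szzBakryEmeryConstSU/SO`, `szzThresholdSU/SO`, `szzBakryEmeryConstSU_pos_iff`,
  `szzBakryEmeryConstSO_pos_iff`). The `8` is `2 + 6`: each link lies in `2(d-1)` plaquettes and has
  `3` partner links in each (SZZ Lemma 4.1, `|Hess_S(v,v)| ≤ 8(d-1)N|β||v|²`, against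
  `Ric = (α(N+2)/4 - 1)|v|²`, SZZ (4.8)).
* Cao–Nissim–Sheffield, arXiv:2509.04688, Definition 1.4 and (3.1)–(3.2): running the same argument
  on the Durhuus–Fröhlich slab `σ`-models (spins on vertices: `2(d-1) + 2(d-1) = 4(d-1)`) gives
  `K = (N+2)/2 - 1 - 4Nβ(d-1)` and the thresholds `β*_{SU(N)} = β*_{U(N)} = 1/(8(d-1))`,
  `β*_{SO(N)} = 1/(16(d-1)) - 1/(8N(d-1))` — twice Shen–Zhu–Zhu's (`cnsThresholdSU/SO`,
  `szzThresholdSU_eq_half_cnsThresholdSU`, `szzThresholdSO_eq_half_cnsThresholdSO`) — and their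
  Theorem 1.6: Wilson's area law for `β < β*_G`, `G ∈ {U(N), SU(N), SO(2(N-1))}`, `N ≥ 2`, `d ≥ 2`.
  The `SU(N)`/`U(N)` cases are the named fact `caoNissimSheffield_tHooft_areaLaw` below, in the torus
  vocabulary of `ConstructiveQFTWave0` exactly as the tree's `cao_nissim_sheffield`
  (arXiv:2505.16585 Thm. 1.2, existential `β₀(d)`); its corollary in the shape `HasAreaLaw` is proved.

What is NOT here: the `SO(2(N-1))` case of CNS Thm. 1.6 (the tree has no `SO(N)` gauge-group
prelude; `-- TODO(general form)` below); CNS Prop. 3.2 (the boundary-uniform slab `σ`-model mass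
gap) and Durhuus–Fröhlich 1980 Thms. 1.2–1.3, which are the two halves of the printed proof; the
Shen–Zhu–Zhu theorem itself, which is the tree's `shen_zhu_zhu` (proved: `shen_zhu_zhu_holds`).

Normalisation (as recorded for `shen_zhu_zhu`): the tree's torus Wilson measure `wilsonMeasure ρ β'`
has weight `exp(-β' ∑ₚ (N - Re Tr ρ(U_p)))`, so the 't Hooft coupling `β` of SZZ/CNS is `β' = N β`.

## References

* H. Shen, R. Zhu, X. Zhu, CMP 400 (2023) 805–851, arXiv:2204.12737v1: Assumption 1.1 (p. 4),
  (1.3) (p. 4), Lemma 4.1 (4.2) (p. 17), (4.7)–(4.8) (p. 19) [ShenZhuZhuCMP2023].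
* S. Cao, R. Nissim, S. Sheffield, *Dynamical approach to area law for lattice Yang–Mills*,
  arXiv:2509.04688v2: Definition 1.4, Theorem 1.6, Remark 1.7 (p. 2), Proposition 3.2, (3.1)–(3.2)
  (p. 4–5) [CaoNissimSheffield2025dynamical].
* B. Durhuus, J. Fröhlich, CMP 75 (1980) 103–151, Thms. 1.2–1.3 (cited through CNS Thm. 2.3).
-/

noncomputable section

open MeasureTheory
open Literature.MathematicalPhysics.QuantumLattice

namespace Literature.MathematicalPhysics.QuantumFieldTheory

/-! ### Shen–Zhu–Zhu's Bakry–Émery constant and threshold -/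

/-- Shen–Zhu–Zhu's Bakry–Émery constant for `G = SU(N)` in dimension `d` at 't Hooft coupling `β`:
`K_S = (N+2)/2 - 1 - 8N|β|(d-1)` (Ricci curvature `(N+2)/2 - 1 = N/2` of `SU(N)` for the
Hilbert–Schmidt metric minus the Hessian bound `8(d-1)N|β|` of Lemma 4.1). It is the log-Sobolev /
Poincaré / `L²`-spectral-gap constant of their Theorems 1.2 and 1.4. [cite: ShenZhuZhuCMP2023, Assumption 1.1] -/
def szzBakryEmeryConstSU (N d : ℕ) (β : ℝ) : ℝ :=
  ((N : ℝ) + 2) / 2 - 1 - 8 * N * |β| * ((d : ℝ) - 1)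

/-- Shen–Zhu–Zhu's Bakry–Émery constant for `G = SO(N)`: `K_S = (N+2)/4 - 1 - 8N|β|(d-1)`. [cite: ShenZhuZhuCMP2023, Assumption 1.1] -/
def szzBakryEmeryConstSO (N d : ℕ) (β : ℝ) : ℝ :=
  ((N : ℝ) + 2) / 4 - 1 - 8 * N * |β| * ((d : ℝ) - 1)

/-- Shen–Zhu–Zhu's strong-coupling threshold for `SU(N)`, `β₀ = 1/(16(d-1))` (independent of `N`):
Assumption 1.1 holds iff `|β| < β₀` (their (1.3)). [cite: ShenZhuZhuCMP2023, (1.3)] -/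
def szzThresholdSU (d : ℕ) : ℝ := 1 / (16 * ((d : ℝ) - 1))

/-- Shen–Zhu–Zhu's strong-coupling threshold for `SO(N)`, `β₀ = 1/(32(d-1)) - 1/(16N(d-1))`
(`= (N-2)/(32N(d-1))`, as printed in their abstract). [cite: ShenZhuZhuCMP2023, (1.3)] -/
def szzThresholdSO (N d : ℕ) : ℝ := 1 / (32 * ((d : ℝ) - 1)) - 1 / (16 * N * ((d : ℝ) - 1))

/-- Unfolding `szzBakryEmeryConstSU`: `K_S = N/2 - 8N|β|(d-1)`. [cite: ShenZhuZhuCMP2023, Assumption 1.1] -/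
theorem szzBakryEmeryConstSU_eq (N d : ℕ) (β : ℝ) :
    szzBakryEmeryConstSU N d β = (N : ℝ) / 2 - 8 * N * |β| * ((d : ℝ) - 1) := by
  unfold szzBakryEmeryConstSU; ring

/-- **Shen–Zhu–Zhu, "Assumption 1.1 is equivalent to (1.3)"**, `SU(N)` case: for `d ≥ 2` and
`N ≥ 1`, `K_S > 0 ↔ |β| < 1/(16(d-1))`. [cite: ShenZhuZhuCMP2023, (1.3)] -/
theorem szzBakryEmeryConstSU_pos_iff {N d : ℕ} (hd : 2 ≤ d) (hN : 1 ≤ N) (β : ℝ) :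
    0 < szzBakryEmeryConstSU N d β ↔ |β| < szzThresholdSU d := by
  have hd' : (0 : ℝ) < (d : ℝ) - 1 := by
    have : (2 : ℝ) ≤ d := by exact_mod_cast hd
    linarith
  have hN' : (0 : ℝ) < N := by exact_mod_cast hN
  rw [szzBakryEmeryConstSU_eq, szzThresholdSU, lt_div_iff₀ (by positivity)]
  constructor
  · intro h
    nlinarith [mul_pos hN' hd']
  · intro h
    nlinarith [mul_pos hN' hd', abs_nonneg β]

/-- **Shen–Zhu–Zhu, "Assumption 1.1 is equivalent to (1.3)"**, `SO(N)` case: for `d ≥ 2` and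
`N ≥ 1`, `K_S > 0 ↔ |β| < 1/(32(d-1)) - 1/(16N(d-1))`. [cite: ShenZhuZhuCMP2023, (1.3)] -/
theorem szzBakryEmeryConstSO_pos_iff {N d : ℕ} (hd : 2 ≤ d) (hN : 1 ≤ N) (β : ℝ) :
    0 < szzBakryEmeryConstSO N d β ↔ |β| < szzThresholdSO N d := by
  have hd' : (0 : ℝ) < (d : ℝ) - 1 := by
    have : (2 : ℝ) ≤ d := by exact_mod_cast hd
    linarith
  have hN' : (0 : ℝ) < N := by exact_mod_cast hN
  have h32 : (0 : ℝ) < 32 * ((d : ℝ) - 1) := by positivity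
  have h16 : (0 : ℝ) < 16 * N * ((d : ℝ) - 1) := by positivity
  have key : szzThresholdSO N d = (((N : ℝ) + 2) / 4 - 1) / (8 * N * ((d : ℝ) - 1)) := by
    unfold szzThresholdSO
    field_simp
    ring
  rw [key, lt_div_iff₀ (by positivity), szzBakryEmeryConstSO]
  constructor
  · intro h; linarith
  · intro h; linarith

/-! ### Cao–Nissim–Sheffield's constants (vertex `σ`-model on slabs) -/

/-- Cao–Nissim–Sheffield's Bakry–Émery constant for the slab `σ`-model with `G = SU(N)`:
`K_{S_{A,B}} = (N+2)/2 - 1 - 4Nβ(d-1)` (Hessian bound `4(d-1)Nβ`, their (3.1), in place of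
Shen–Zhu–Zhu's `8(d-1)N|β|`). [cite: CaoNissimSheffield2025dynamical, (3.2)] -/
def cnsBakryEmeryConstSU (N d : ℕ) (β : ℝ) : ℝ :=
  ((N : ℝ) + 2) / 2 - 1 - 4 * N * β * ((d : ℝ) - 1)

/-- Cao–Nissim–Sheffield's Bakry–Émery constant for the slab `σ`-model with `G = SO(N)`:
`K_{S_{A,B}} = (N+2)/4 - 1 - 4Nβ(d-1)`. [cite: CaoNissimSheffield2025dynamical, (3.2)] -/
def cnsBakryEmeryConstSO (N d : ℕ) (β : ℝ) : ℝ :=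
  ((N : ℝ) + 2) / 4 - 1 - 4 * N * β * ((d : ℝ) - 1)

/-- Cao–Nissim–Sheffield's threshold `β*_{SU(N)} = β*_{U(N)} := 1/(8(d-1))`. [cite: CaoNissimSheffield2025dynamical, Definition 1.4] -/
def cnsThresholdSU (d : ℕ) : ℝ := 1 / (8 * ((d : ℝ) - 1))

/-- Cao–Nissim–Sheffield's threshold `β*_{SO(N)} := 1/(16(d-1)) - 1/(8N(d-1))`. [cite: CaoNissimSheffield2025dynamical, Definition 1.4] -/
def cnsThresholdSO (N d : ℕ) : ℝ := 1 / (16 * ((d : ℝ) - 1)) - 1 / (8 * N * ((d : ℝ) - 1))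

/-- "The assumption that `β < β*_G` is equivalent to `K_{S_{A,B}} > 0`" (CNS, after (3.2)),
`SU(N)` case, `d ≥ 2`, `N ≥ 1`. [cite: CaoNissimSheffield2025dynamical, (3.2)] -/
theorem cnsBakryEmeryConstSU_pos_iff {N d : ℕ} (hd : 2 ≤ d) (hN : 1 ≤ N) (β : ℝ) :
    0 < cnsBakryEmeryConstSU N d β ↔ β < cnsThresholdSU d := by
  have hd' : (0 : ℝ) < (d : ℝ) - 1 := by
    have : (2 : ℝ) ≤ d := by exact_mod_cast hd
    linarith
  have hN' : (0 : ℝ) < N := by exact_mod_cast hN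
  have key : cnsThresholdSU d = (((N : ℝ) + 2) / 2 - 1) / (4 * N * ((d : ℝ) - 1)) := by
    unfold cnsThresholdSU
    field_simp
    ring
  rw [key, lt_div_iff₀ (by positivity), cnsBakryEmeryConstSU]
  constructor
  · intro h; linarith
  · intro h; linarith

/-- Same, `SO(N)` case. [cite: CaoNissimSheffield2025dynamical, (3.2)] -/
theorem cnsBakryEmeryConstSO_pos_iff {N d : ℕ} (hd : 2 ≤ d) (hN : 1 ≤ N) (β : ℝ) :
    0 < cnsBakryEmeryConstSO N d β ↔ β < cnsThresholdSO N d := by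
  have hd' : (0 : ℝ) < (d : ℝ) - 1 := by
    have : (2 : ℝ) ≤ d := by exact_mod_cast hd
    linarith
  have hN' : (0 : ℝ) < N := by exact_mod_cast hN
  have key : cnsThresholdSO N d = (((N : ℝ) + 2) / 4 - 1) / (4 * N * ((d : ℝ) - 1)) := by
    unfold cnsThresholdSO
    field_simp
    ring
  rw [key, lt_div_iff₀ (by positivity), cnsBakryEmeryConstSO]
  constructor
  · intro h; linarith
  · intro h; linarith

/-- "The threshold appearing in [SZZ23] is half the threshold in the current paper" (CNS p. 2),
`SU(N)`: `1/(16(d-1)) = (1/2) · 1/(8(d-1))`. [cite: CaoNissimSheffield2025dynamical, Remark 1.5 ff.] -/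
theorem szzThresholdSU_eq_half_cnsThresholdSU (d : ℕ) :
    szzThresholdSU d = cnsThresholdSU d / 2 := by
  unfold szzThresholdSU cnsThresholdSU
  rcases eq_or_ne ((d : ℝ) - 1) 0 with h | h
  · simp [h]
  · field_simp
    ring

/-- Same for `SO(N)`: `1/(32(d-1)) - 1/(16N(d-1)) = (1/2)(1/(16(d-1)) - 1/(8N(d-1)))`. [cite: CaoNissimSheffield2025dynamical, Remark 1.5 ff.] -/
theorem szzThresholdSO_eq_half_cnsThresholdSO (N d : ℕ) :
    szzThresholdSO N d = cnsThresholdSO N d / 2 := by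
  unfold szzThresholdSO cnsThresholdSO
  rcases eq_or_ne ((d : ℝ) - 1) 0 with h | h
  · simp [h]
  · rcases eq_or_ne (N : ℝ) 0 with hN | hN
    · simp [hN]; ring
    · field_simp
      ring

/-- Numerical instance (`d = 4`, any `N`): Shen–Zhu–Zhu's `SU(N)` threshold is `1/48` and
Cao–Nissim–Sheffield's is `1/24`. [cite: CaoNissimSheffield2025dynamical, Definition 1.4] -/
theorem szzThresholdSU_four : szzThresholdSU 4 = 1 / 48 ∧ cnsThresholdSU 4 = 1 / 24 := by
  unfold szzThresholdSU cnsThresholdSU; norm_num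

/-! ### The Cao–Nissim–Sheffield area law in the 't Hooft regime (named fact) -/

section AreaLaw

variable {d N : ℕ}

variable (d N) in
/-- **Cao–Nissim–Sheffield, area law in the 't Hooft regime** (arXiv:2509.04688v2, Theorem 1.6,
cases `G = SU(N)` and `G = U(N)`). "Let `d ≥ 2`, `N ≥ 2`, and `G ∈ {U(N), SU(N), SO(2(N-1))}`. Then
for `β < β*_G`, there are constants `C = C(β,d,N)` and `c = c(β,d,N)` such that for any rectangular
loop `ℓ` in the lattice `Λ`, where the side lengths of `ℓ` are at most `L/2`, we have that
`|⟨W_ℓ⟩_{Λ,β}| ≤ C exp(-c·area(ℓ))`", with `Λ = Λ_L` the discrete torus `ℤ^d/Lℤ^d` (their Remark 1.2),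
`dμ = Z⁻¹ exp(Nβ ∑_{p ∈ P⁺_Λ} Re Tr(Q_p)) dQ` ((1.1)–(1.2)), `W_ℓ = (1/N) Tr(Q_ℓ)` (Definition 1.3) and
`β*_{SU(N)} = β*_{U(N)} = 1/(8(d-1))` (Definition 1.4, `cnsThresholdSU`). Rendered in the torus
vocabulary of `ConstructiveQFTWave0` (as the tree's `cao_nissim_sheffield`): coupling `N β` in
`wilsonExpectation` (normalisation note in the module docstring), the real Wilson loop
`wilsonLoop ρ = (1/N) Re Tr ρ(U_ℓ)` (so the bound on `|Re ⟨W_ℓ⟩| ≤ |⟨W_ℓ⟩|` is implied by the printed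
one), rectangular `R × T` loops in a coordinate plane with `1 ≤ R, T`, `2R, 2T ≤ L`, area `RT`.
**Flags:** (a) stated for `0 ≤ β < β*` (the paper writes "`β < β*_G`"; its Bakry–Émery argument is
for `β ≥ 0`, and we do not assert the negative-`β` range); (b) we read "constants `C, c`" with
`0 < c` (otherwise the display is vacuous; the proof produces `c` from the Durhuus–Fröhlich mass gap
`C₂ > 0`); (c) the `SO(2(N-1))` case is omitted — TODO(general form): add it once an `SO(N)` prelude
exists. Proof in the source: Prop. 3.2 (uniform slab `σ`-model mass gap from the Bakry–Émery
condition (3.2) with `K = cnsBakryEmeryConstSU N d β > 0`) + Durhuus–Fröhlich 1980 Thms. 1.2–1.3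
(their Thm. 2.3) + the `U(N) = U(1) × SU(N)` conditioning (Cor. 3.6). [cite: CaoNissimSheffield2025dynamical, Theorem 1.6] -/
def caoNissimSheffield_tHooft_areaLaw : Prop :=
  ∀ (hd : 2 ≤ d) (hN : 2 ≤ N) (β : ℝ), 0 ≤ β → β < cnsThresholdSU d →
    (∃ C c : ℝ, 0 < c ∧ ∀ (L : ℕ) [NeZero L] (x : Site d L) (i j : Fin d) (R T : ℕ), i ≠ j →
        1 ≤ R → 1 ≤ T → 2 * R ≤ L → 2 * T ≤ L →
          |wilsonExpectation (fundamentalRep (Fin N)) (N * β)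
              (wilsonLoop (fundamentalRep (Fin N)) x i j R T)| ≤ C * Real.exp (-c * (R * T))) ∧
    (∃ C c : ℝ, 0 < c ∧ ∀ (L : ℕ) [NeZero L] (x : Site d L) (i j : Fin d) (R T : ℕ), i ≠ j →
        1 ≤ R → 1 ≤ T → 2 * R ≤ L → 2 * T ≤ L →
          |wilsonExpectation (unitaryFundamentalRep (Fin N) ℂ) (N * β)
              (wilsonLoop (unitaryFundamentalRep (Fin N) ℂ) x i j R T)| ≤ C * Real.exp (-c * (R * T)))

/-- A bound `C e^{-c RT}` for `R + T ≥ 1` is a bound `max(C,1)^{2(R+T)} e^{-c RT}`, the shape of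
`HasAreaLaw` (private helper). [folklore] -/
private theorem le_max_one_pow_of_le {a C : ℝ} {n : ℕ} (hn : 1 ≤ n) (h : a ≤ C) : a ≤ max C 1 ^ n := by
  calc a ≤ C := h
    _ ≤ max C 1 := le_max_left _ _
    _ = max C 1 ^ 1 := (pow_one _).symm
    _ ≤ max C 1 ^ n := pow_le_pow_right₀ (le_max_right _ _) hn

/-- **Corollary** (CNS Thm. 1.6 in the shape of the tree's finite-volume area law `HasAreaLaw`):
under `caoNissimSheffield_tHooft_areaLaw d N`, for `d ≥ 2`, `N ≥ 2` and `0 ≤ β < 1/(8(d-1))` the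
`SU(N)` lattice Yang–Mills theory at tree coupling `N β` satisfies `HasAreaLaw`. [cite: CaoNissimSheffield2025dynamical, Theorem 1.6] -/
theorem caoNissimSheffield_tHooft_areaLaw.hasAreaLaw_SU (h : caoNissimSheffield_tHooft_areaLaw d N)
    (hd : 2 ≤ d) (hN : 2 ≤ N) {β : ℝ} (hβ0 : 0 ≤ β) (hβ : β < cnsThresholdSU d) :
    HasAreaLaw d (fundamentalRep (Fin N)) ((N : ℝ) * β) := by
  obtain ⟨⟨C, c, hc, hW⟩, -⟩ := h hd hN β hβ0 hβ
  refine ⟨max C 1, c, hc, fun L _ x i j R T hij hR hT hRL hTL => ?_⟩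
  have h1 := hW L x i j R T hij hR hT hRL hTL
  have hexp : 0 < Real.exp (-c * ((R : ℝ) * T)) := Real.exp_pos _
  have h2 : |wilsonExpectation (fundamentalRep (Fin N)) ((N : ℝ) * β)
      (wilsonLoop (fundamentalRep (Fin N)) x i j R T)| / Real.exp (-c * ((R : ℝ) * T)) ≤ C := by
    rw [div_le_iff₀ hexp]; exact h1
  have h3 := le_max_one_pow_of_le (n := 2 * (R + T)) (by omega) h2
  rwa [div_le_iff₀ hexp] at h3

/-- Same corollary for `U(N)`. [cite: CaoNissimSheffield2025dynamical, Theorem 1.6] -/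
theorem caoNissimSheffield_tHooft_areaLaw.hasAreaLaw_U (h : caoNissimSheffield_tHooft_areaLaw d N)
    (hd : 2 ≤ d) (hN : 2 ≤ N) {β : ℝ} (hβ0 : 0 ≤ β) (hβ : β < cnsThresholdSU d) :
    HasAreaLaw d (unitaryFundamentalRep (Fin N) ℂ) ((N : ℝ) * β) := by
  obtain ⟨-, ⟨C, c, hc, hW⟩⟩ := h hd hN β hβ0 hβ
  refine ⟨max C 1, c, hc, fun L _ x i j R T hij hR hT hRL hTL => ?_⟩
  have h1 := hW L x i j R T hij hR hT hRL hTL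
  have hexp : 0 < Real.exp (-c * ((R : ℝ) * T)) := Real.exp_pos _
  have h2 : |wilsonExpectation (unitaryFundamentalRep (Fin N) ℂ) ((N : ℝ) * β)
      (wilsonLoop (unitaryFundamentalRep (Fin N) ℂ) x i j R T)| / Real.exp (-c * ((R : ℝ) * T)) ≤ C := by
    rw [div_le_iff₀ hexp]; exact h1
  have h3 := le_max_one_pow_of_le (n := 2 * (R + T)) (by omega) h2
  rwa [div_le_iff₀ hexp] at h3

/-- The Shen–Zhu–Zhu regime is contained in the Cao–Nissim–Sheffield regime: `|β| < 1/(16(d-1))`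
implies `β < 1/(8(d-1))` for `d ≥ 2`. [cite: CaoNissimSheffield2025dynamical, Remark 1.5 ff.] -/
theorem lt_cnsThresholdSU_of_abs_lt_szzThresholdSU {d : ℕ} (hd : 2 ≤ d) {β : ℝ}
    (h : |β| < szzThresholdSU d) : β < cnsThresholdSU d := by
  have hd' : (0 : ℝ) < (d : ℝ) - 1 := by
    have : (2 : ℝ) ≤ d := by exact_mod_cast hd
    linarith
  have hpos : 0 < cnsThresholdSU d := by unfold cnsThresholdSU; positivity
  rw [szzThresholdSU_eq_half_cnsThresholdSU] at h
  linarith [le_abs_self β]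

end AreaLaw

end Literature.MathematicalPhysics.QuantumFieldTheory
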